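/-
Copyright (c) 2026 the pub-hodgecm-mathlib formalisation cell (harness21).  Prover seat hodgecm-mathlib-K2E3-p31 (g3), HCML Track B, programme R90-TF
(Rogawski 1990 trace formula), section S4 = Ch. 13.1–2, base `R90-C131`; S4 dealer K2E2-plan (g8∕g9), rulings S4-R59 (2) ∕ S4-R85 (b) ∕ S4-R89 (2):
«(J̃♭-Σ) ASSEMBLER OF RECORD» — THE PAYER of the ONE (J̃♭) socket of S4 FILE C ED. 6.  2026-09-05.
-/
import Summits.HodgeConjecture.HodgeConjecture.Theorems.R90S4TwistedTubeJacobianOfRecord     -- ★ p865413 Σ-2 (this seat): `twistedTubeJacobian_of_record_of_bridge` (socket bytes + model frame + `Hmodel`); brings ★ p865316 Σ-1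
import Summits.HodgeConjecture.HodgeConjecture.Theorems.R90S4TwistedTubeModelGtLoc           -- ★ DATUM BRIDGE head (K2E4-p11): `twistedTubeJacobianLocal_model_gtLoc`; brings ★ p865390 Letters (K2E3-p36), ★ SING-ε one-place model
import HarnessLib

/-!
# R90-TF · S4 «Ch. 13.1–2» · road (J̃♭) — THE TWISTED TUBE JACOBIAN LETTER OF RECORD (PAYER of the C ED. 6 socket `stub_R90_S4_twistedTubeJacobian`)

Cell `hodgecm-mathlib`, crux H413 (`stmt-HodgeConjecture-24833`, lane `--supports … --as helper`), route of record `HCCMUnconditional` (no route verbs;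
count-neutral).  THEOREMS ONLY (no `def`, no `instance`, no notation, no named-fact hypothesis, no `sorry`); ★-only imports, NO `Lines` import.
(Separate file rather than an ED. 2 append of Σ-2 by the 400-line rule — S4-R89 (2) fallback; the decl name is the dealt one.)

**`twistedTubeJacobian_of_record`** — THE (J̃♭) LETTER (3′) with EXACTLY the socket's binders (typ1 (g2) v3 :85–:118 without `hTc`; `GLoc` spelled `Gqs`, rfl-equal):
★ Σ-2 `twistedTubeJacobian_of_record_of_bridge` at the one-place model of the unique place `w ∣ v` — `K := L_w`, `ρG :=` ★ SING-ε's
`(localGLPiEquiv L 3 v).trans (localGLPiEvalEquiv c̄ 3 _ w hw)` (`hρπ := rfl`), `σ := σ_w`, `J := Φ₃ = splitForm` — with the thirteen one-place letters of ★ p865390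
`R90S4TwistedTubeModelGtLocLetters` (K2E3-p36 (g4)) and the MODEL ROW ★ `R90S4TwistedTubeModelGtLoc.twistedTubeJacobianLocal_model_gtLoc` (K2E4-p11 (g10)) BY NAME.
The road behind it (all ★): (TJ5-abs) p864907 `twistedTubeJacobian_of_local` (K2E3-p03) ← (TJ5-win) p864964 · MODEL p864950∕p864971∕p865006∕p865097∕p865304∕p865390∕GtLoc
head · (TJ6) p864986∕p865121∕p865139∕p865164∕p865217∕p865049∕p865159∕p865254 + Letters · W-LOC∕DATUM · Σ-1 p865316 · Σ-2 p865413.  C ED. 7 body (typ1 lineage):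
`exact twistedTubeJacobian_of_record L v hv νGt T γ₀ hγ₀ hT hδ₀T hδ₀reg τ' h1 Ψ hΨ N' hN' s hsm hsN R hRN hRcov hRinj tT htc`.
HONEST LABEL: HC_CM is proved only modulo the 7 printed citations (2 remaining named inputs: hLiu418 = `stmt-HodgeConjecture-24832`, h413 =
`stmt-HodgeConjecture-24833`) until rung 0 closes.  This file pays C's ONE (J̃♭) sub-socket only (once C ED. 7 is written and built); (W-NP) is paid only modulo it;
C1∕C4∕C5∕(U2-HC) stay OPEN; helper lane closes no item; REL ≠ ★ ≠ BUILT.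

## References
* [Rogawski1990] J. D. Rogawski, *Automorphic Representations of Unitary Groups in Three Variables*, Ann. of Math. Stud. 123 (1990), §12.5 p. 186; §4.10
  pp. 62–64; §3.11 Prop. 3.11.1 pp. 34–35.
* [HarishChandra1970] Harish-Chandra (notes by G. van Dijk), *Harmonic Analysis on Reductive p-adic Groups*, LNM 162 (1970), Lemma 22. Context locator.
-/

set_option autoImplicit false
-- the mandated namespace repeats the single-problem summit's segment (`HodgeConjecture.HodgeConjecture`)
set_option linter.dupNamespace false

noncomputable section

open MeasureTheory Measure Set Filter Topology Function NumberField IsDedekindDomain Matrix ValuativeRel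
open scoped ENNReal NNReal MatrixGroups Pointwise
open Literature.MeasureTheory.Group
open Literature.NumberTheory.Rogawski1990 Literature.NumberTheory.Rogawski1990.Ch4Sec10
open Literature.NumberTheory.Automorphic Literature.NumberTheory.Automorphic.UnitaryGroup
open Literature.NumberTheory.Weil1982.UnitaryFinTopForm
open Summit.HodgeConjecture.HodgeConjecture.Cruxes.H413.F0P3InnerFormClassificationV6 (splitForm)

namespace Summit.HodgeConjecture.HodgeConjecture.R90.S4

section Payer

variable {L : Type} [Field L] [NumberField L] [IsCMField L] {v : HeightOneSpectrum (𝓞 ↥(maximalRealSubfield L))}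

variable (L v) in
set_option maxHeartbeats 800000 in  -- the socket bytes; one call of `twistedTubeJacobian_of_record_of_bridge` at the one-place model `K := L_w`
/-- **THE TWISTED TUBE JACOBIAN LETTER OF RECORD — PAYER of the C ED. 6 socket `stub_R90_S4_twistedTubeJacobian`** (its bytes VERBATIM: typ1 (g2) v3 :85–:118
without `hTc`, `GLoc` spelled `Gqs`).  For a Cartan `T = Cent_{G_v}(γ₀)` (`γ₀` regular), `T̃ = Cent_{G̃_v}(γ₀)`, an ε-regular `δ₀ ∈ T̃` with ε-centraliser `T′` and
core-one Haar `τ′`, the twisted family `Ψ(xT′, b) = x b ε(x)⁻¹`, a Borel norm section `s : T → T̃`, a norm-one sheet transversal `R`, and the core-one Haar `tT` of `T`: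
every point `b₁` of the sheeted transversal has a `T̃`-window `U′ ∋ b₁` and a Borel `A₀ ⊆ G̃_v ⧸ T′` of positive finite `νGt ∕ τ′`-measure with
`νGt(Ψ(A₀ × s(V)·u)) = (νGt∕τ′)(A₀) · ∫⁻_V D_T dt_T` for every sheet `u ∈ R` and Borel `V ⊆ T^{reg}` with sheet image in `U′` — «`dδ̃ = D_G(Nδ)² dδ` on the twisted
tube».  PROOF = `twistedTubeJacobian_of_record_of_bridge` at the one-place model of the unique place `w ∣ v` (`K := L_w`,
`ρG :=` ★ `(localGLPiEquiv L 3 v).trans (localGLPiEvalEquiv c̄ 3 _ w hw)`, `σ := σ_w`, `J := Φ₃`) with the letters of ★ p865390 `R90S4TwistedTubeModelGtLocLetters`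
(K2E3-p36) and the MODEL ROW ★ `R90S4TwistedTubeModelGtLoc.twistedTubeJacobianLocal_model_gtLoc` (K2E4-p11) BY NAME.
[cite: Rogawski1990, §12.5 p. 186; §4.10 pp. 62–64] [cite: HarishChandra1970, Lemma 22] -/
theorem twistedTubeJacobian_of_record (hv : ∀ w : PlacesOver L v, IsCMField.complexConj L • w.1 = w.1)
    [LocallyCompactSpace (GtLoc L v)] [SecondCountableTopology (GtLoc L v)] [T2Space (GtLoc L v)] :
    letI : MeasurableSpace (Gqs L v) := borel _
    letI : MeasurableSpace (GtLoc L v) := borel _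
    letI : ∀ δ : GtLoc L v, MeasurableSpace (GtLoc L v ⧸ epsCentralizer (epsLoc L (splitFormGL L) v) δ) := fun _ => borel _
    haveI : BorelSpace (Gqs L v) := ⟨rfl⟩
    haveI : BorelSpace (GtLoc L v) := ⟨rfl⟩
    haveI : ∀ δ : GtLoc L v, BorelSpace (GtLoc L v ⧸ epsCentralizer (epsLoc L (splitFormGL L) v) δ) := fun _ => ⟨rfl⟩
    ∀ (νGt : Measure (GtLoc L v)) [νGt.IsHaarMeasure] [νGt.IsMulRightInvariant]
      (T : Subgroup (Gqs L v)) (γ₀ : Gqs L v) (hγ₀ : IsRegularElt (γ₀.val : GtLoc L v))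
      (hT : T = Subgroup.centralizer ({γ₀} : Set (Gqs L v)))
      ⦃δ₀ : GtLoc L v⦄ (hδ₀T : δ₀ ∈ Subgroup.centralizer ({(γ₀.val : GtLoc L v)} : Set (GtLoc L v))) (hδ₀reg : IsEpsRegularAt L (splitFormGL L) v δ₀)
      (τ' : Measure ↥(epsCentralizer (epsLoc L (splitFormGL L) v) δ₀)) [τ'.IsHaarMeasure] [τ'.IsInvInvariant]
      (h1 : τ' (compactCore ↥(epsCentralizer (epsLoc L (splitFormGL L) v) δ₀)) = 1)
      (Ψ : (GtLoc L v ⧸ epsCentralizer (epsLoc L (splitFormGL L) v) δ₀) × ↥(Subgroup.centralizer ({(γ₀.val : GtLoc L v)} : Set (GtLoc L v))) → GtLoc L v)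
      (hΨ : ∀ (x : GtLoc L v) (b : ↥(Subgroup.centralizer ({(γ₀.val : GtLoc L v)} : Set (GtLoc L v)))), Ψ (QuotientGroup.mk x, b) = x * b * (epsLoc L (splitFormGL L) v x)⁻¹)
      (N' : Subgroup (GtLoc L v))
      (hN' : ∀ m, m ∈ N' ↔ m ∈ Subgroup.normalizer ((Subgroup.centralizer ({(γ₀.val : GtLoc L v)} : Set (GtLoc L v))) : Set (GtLoc L v)) ∧
        m * (epsLoc L (splitFormGL L) v m)⁻¹ ∈ Subgroup.centralizer ({(γ₀.val : GtLoc L v)} : Set (GtLoc L v)))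
      (s : ↥T → ↥(Subgroup.centralizer ({(γ₀.val : GtLoc L v)} : Set (GtLoc L v)))) (hsm : Measurable s)
      (hsN : ∀ t : ↥T, epsNorm (epsLoc L (splitFormGL L) v) (s t : GtLoc L v) = ((t : Gqs L v)).val)
      (R : Finset ↥(Subgroup.centralizer ({(γ₀.val : GtLoc L v)} : Set (GtLoc L v))))
      (hRN : ∀ u ∈ R, epsNorm (epsLoc L (splitFormGL L) v) (u : GtLoc L v) = 1)
      (hRcov : ∀ w : ↥(Subgroup.centralizer ({(γ₀.val : GtLoc L v)} : Set (GtLoc L v))), epsNorm (epsLoc L (splitFormGL L) v) (w : GtLoc L v) = 1 →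
        ∃ u ∈ R, ∃ a : ↥(Subgroup.centralizer ({(γ₀.val : GtLoc L v)} : Set (GtLoc L v))), (w : GtLoc L v) = u * (a * (epsLoc L (splitFormGL L) v a)⁻¹))
      (hRinj : ∀ u ∈ R, ∀ u' ∈ R, (∃ a : ↥(Subgroup.centralizer ({(γ₀.val : GtLoc L v)} : Set (GtLoc L v))),
        ((u' : ↥(Subgroup.centralizer ({(γ₀.val : GtLoc L v)} : Set (GtLoc L v)))) : GtLoc L v) = u * (a * (epsLoc L (splitFormGL L) v a)⁻¹)) → u = u')
      (tT : Measure ↥T) [tT.IsHaarMeasure] [tT.IsInvInvariant] (htc : tT (compactCore ↥T) = 1),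
      ∀ b₁ ∈ {b : ↥(Subgroup.centralizer ({(γ₀.val : GtLoc L v)} : Set (GtLoc L v))) | ∃ t : ↥T, IsRegularElt (((t : Gqs L v)).val : GtLoc L v) ∧ ∃ u ∈ R, b = s t * u},
        ∃ U' : Set ↥(Subgroup.centralizer ({(γ₀.val : GtLoc L v)} : Set (GtLoc L v))), IsOpen U' ∧ b₁ ∈ U' ∧
        ∃ A₀ : Set (GtLoc L v ⧸ epsCentralizer (epsLoc L (splitFormGL L) v) δ₀), MeasurableSet A₀ ∧ (quotientMeasure (epsCentralizer (epsLoc L (splitFormGL L) v) δ₀) τ' (isClosed_epsCentralizer L (splitFormGL L) v δ₀) νGt) A₀ ≠ 0 ∧ (quotientMeasure (epsCentralizer (epsLoc L (splitFormGL L) v) δ₀) τ' (isClosed_epsCentralizer L (splitFormGL L) v δ₀) νGt) A₀ ≠ ⊤ ∧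
          ∀ u ∈ R, ∀ V : Set ↥T, MeasurableSet V → V ⊆ {t : ↥T | IsRegularElt (((t : Gqs L v)).val : GtLoc L v)} → (fun t : ↥T => s t * u) '' V ⊆ U' →
            νGt (Ψ '' (A₀ ×ˢ ((fun t : ↥T => s t * u) '' V))) = (quotientMeasure (epsCentralizer (epsLoc L (splitFormGL L) v) δ₀) τ' (isClosed_epsCentralizer L (splitFormGL L) v δ₀) νGt) A₀ * ∫⁻ t in V, (cartanWeight L v T t : ℝ≥0∞) ∂tT := by
  intro νGt _ _ T γ₀ hγ₀ hT δ₀ hδ₀T hδ₀reg τ' _ _ h1 Ψ hΨ N' hN' s hsm hsN R hRN hRcov hRinj tT _ _ htc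
  -- the frame's Borel σ-algebras as local instances (the statement's `letI`s are transparent)
  letI : MeasurableSpace (Gqs L v) := borel _
  letI : MeasurableSpace (GtLoc L v) := borel _
  letI : ∀ δ : GtLoc L v, MeasurableSpace (GtLoc L v ⧸ epsCentralizer (epsLoc L (splitFormGL L) v) δ) := fun _ => borel _
  haveI : BorelSpace (Gqs L v) := ⟨rfl⟩
  haveI : BorelSpace (GtLoc L v) := ⟨rfl⟩
  haveI : ∀ δ : GtLoc L v, BorelSpace (GtLoc L v ⧸ epsCentralizer (epsLoc L (splitFormGL L) v) δ) := fun _ => ⟨rfl⟩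
  -- the unique place `w ∣ v` and the one-place model `G̃_v ≃ GL₃(L_w)` (★ SING-ε)
  obtain ⟨w⟩ : Nonempty (PlacesOver L v) := inferInstance
  have hw : IsCMField.complexConj L • w.1 = w.1 := hv w
  haveI : T2Space (w.1.adicCompletion L) := (Literature.NumberTheory.GaloisRepresentations.IsNonarchimedeanLocalField.isLocalField (w.1.adicCompletion L)).toT2Space
  haveI : SecondCountableTopology (w.1.adicCompletion L) := secondCountableTopology_adicCompletion L w.1
  haveI : CharZero (w.1.adicCompletion L) := charZero_of_injective_algebraMap (algebraMap L (w.1.adicCompletion L)).injective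
  haveI : Algebra.IsQuadraticExtension ↥(maximalRealSubfield L) L := IsCMField.isQuadraticExtension L
  let eG : GtLoc L v ≃ₜ* GL (Fin 3) (w.1.adicCompletion L) :=
    (localGLPiEquiv L 3 v).trans (localGLPiEvalEquiv (IsCMField.complexConj L) 3 (IsCMField.complexConj_ne_one L) w hw)
  have hρπ : ∀ δ : GtLoc L v, ((eG.toMulEquiv.toMonoidHom δ : GL (Fin 3) (w.1.adicCompletion L)) : Matrix (Fin 3) (Fin 3) (w.1.adicCompletion L)) =
      δ.val.map (Pi.evalRingHom (fun w' : PlacesOver L v => w'.1.adicCompletion L) w) := fun _ => rfl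
  exact twistedTubeJacobian_of_record_of_bridge L v hv eG.toMulEquiv.toMonoidHom (gtLocModel_injective L v w hw _ hρπ)
    (galAdicCompletionMap (L := L) (IsCMField.complexConj L) hw) (continuous_galAdicCompletionMap L (IsCMField.complexConj L) hw)
    (fun a => galAdicCompletionMap_galAdicCompletionMap_of_smul_eq (IsCMField.complexConj L) w (IsCMField.complexConj_ne_one L) hw a)
    (valuation_galAdicCompletionMap_cm_le L v w hw) (exists_galAdicCompletionMap_cm_ne_self L v w hw)
    ((splitForm L 3).map (algebraMap L (w.1.adicCompletion L))) (isUnit_det_splitFormPlace L v w) (splitFormPlace_map_transpose L v w hw)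
    (valBound_one_splitFormPlace L v w) (valBound_one_splitFormPlace_inv L v w) (gtLocModel_epsLoc L v w hw _ hρπ)
    (fun g hg => gtLocModel_separable_charpoly L v w _ hρπ hg)
    νGt T γ₀ hγ₀ hT hδ₀T hδ₀reg τ' h1 Ψ hΨ N' hN' s hsm hsN R hRN hRcov hRinj tT htc
    (fun φ hφ hφc τA _ _ _ _ _ _ _ b₀ hb₀ hreg =>
      twistedTubeJacobianLocal_model_gtLoc L v w hv eG.toMulEquiv.toMonoidHom hρπ hγ₀ T rfl
        (Set.isClosed_centralizer ({(γ₀.val : GtLoc L v)} : Set (GtLoc L v))) φ hφ hφc νGt τA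
        (fun p : GtLoc L v × ↥(Subgroup.centralizer ({(γ₀.val : GtLoc L v)} : Set (GtLoc L v))) => p.1 * (p.2 : GtLoc L v) * (epsLoc L (splitFormGL L) v p.1)⁻¹) (fun _ _ => rfl) b₀ hb₀ hreg)


end Payer

end Summit.HodgeConjecture.HodgeConjecture.R90.S4

end
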